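import Mathlib
import HarnessLib
import Literature.Analysis.FluidPDE.SuitableWeak
import Literature.Analysis.FluidPDE.SelfSimilar
import Literature.Analysis.FluidPDE.LocalTypeI
import Literature.Analysis.FluidPDE.ESSLocalHolderNoConcentration
import Summits.NavierStokesRegularity.NavierStokesRegularity.Theorems.RellichScarNoMildScar
import Summits.NavierStokesRegularity.NavierStokesRegularity.Theorems.RellichScarApexLocalisationConeZoomLimit
import Summits.NavierStokesRegularity.NavierStokesRegularity.Theorems.RellichScarApexLocalisationConeFarFieldCurl
import Summits.NavierStokesRegularity.NavierStokesRegularity.Theorems.RellichScarApexLocalisationConeFarFieldRepresentative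
import Summits.NavierStokesRegularity.NavierStokesRegularity.Theorems.RellichScarApexLocalisationBallStripLiouville

/-!
# The cone Liouville theorem for rate-Type-I slab profiles (`TracelessConeLiouville`; line calm-cone-carleman,
# crux ApexLocalisation stmt-NavierStokesRegularity-11719, stub `stub_coneLiouville` = K1 for cones)

**Theorem (K1 of the card `calm-cone-carleman`, conditional form).** Let `Γ = Γ_κ(e) = {x | κ‖x‖ < ⟪x,e⟫}` be the
round cone of half-angle `arccos κ` about the unit vector `e` (`0 ≤ κ < 1`; `κ = 0` is the half-space).  ASSUME `Γ`
has the backward uniqueness property (BU) for the backward heat operator with bounded lower-order terms in the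
`C¹₂` class of the tree's `Carleman.backwardUniqueness_uncurried_c12` (bounded `v` on `]0,1[ × Γ`, continuous up to
`t = 0` with `v(0,·) = 0`, `|∂ₜv + Δv| ≤ c₁(|v| + |∇v|)`, `∂ₜv` square integrable on bounded measurable subsets
`⟹ v ≡ 0`) — a THEOREM for `κ < 1/√3` (opening angle `> 2 arccos(1/√3) ≈ 109.5°`, Li–Šverák 2012, Thm. 1.1) and
FALSE for opening angles `< 90°` (Escauriaza).  Then a suitable weak Navier–Stokes solution on the backward slab
with a weak gradient, `𝐈 < ⊤` and the Type-I RATE `‖u(t,x)‖ ≤ C/√(−t)`, which on `Γ` is apex-CALM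
(`‖u(t,x)‖ ≤ K/(‖x‖ + √(−t))`) and scar-FAINT (`‖x‖‖u(t,x)‖ ≤ ε` for `x ∈ Γ`, `‖x‖ < δ(ε)`, `−η(ε)‖x‖² < t < 0`),
is NOT singular at the space–time origin: traceless Type-I singular points are loud in every wide calm cone.

Proof = composition of the four landed cone stubs: S1c `stub_coneZoomLimit` (blow-up at the origin),
S3c `stub_coneFarFieldRepresentative` (smooth far-field representative on the translated cone `s e + Γ`,
`s = R₀ + 1 + 2/(1−κ)`, `R₀ = max K 1`), S2c `stub_coneFarFieldCurl` (far-field vorticity vanishes on `s e + Γ`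
by (BU)), S4' `stub_ballStripLiouville` (from the ball `B(s e + (6/(1−κ)) e, 3) ⊆ s e + Γ`: slices vanish on every
strip `]-1/3, -1/(n+4)[`), then `w = 0` a.e. on `Q(0, 1/2)` against the persistence of the singular origin.
The unconditional half-space case (`κ = 0`, (BU) = ESS 2003 Thm. 5.1, proved in the tree) is
`stub_halfspaceLiouville` (`Theorems/RellichScarApexLocalisationHalfspaceLiouville.lean`).

References: K. Li, V. Šverák, *Backward uniqueness for the heat equation in cones*, CPDE 37 (2012) =
arXiv:1011.2796, Thm. 1.1; J. Wu, W. Wang, JDE 258 (2015) = arXiv:1310.6249 (angle `> 98.99°`); Escauriaza–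
Seregin–Šverák 2003 (Thm. 1.4 scheme, Thms. 4.1, 5.1); Albritton–Barker 2019 = arXiv:1811.00502; KNSS 2009.
-/

noncomputable section

set_option linter.dupNamespace false

namespace Summit.NavierStokesRegularity.NavierStokesRegularity.Theorems.RellichScarApexLocalisation

open MeasureTheory Set Function Metric Filter Topology TopologicalSpace
open scoped ENNReal NNReal InnerProductSpace RealInnerProductSpace
open Literature.Analysis Literature.Analysis.FluidPDE

local notation "E³" => EuclideanSpace ℝ (Fin 3)

/-- The open backward slab `(-∞, 0) × ℝ³` (time first). -/
local notation "𝕊" => Literature.Analysis.FluidPDE.slab (EuclideanSpace ℝ (Fin 3)) (Set.Iio (0 : ℝ)) isOpen_Iio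

/-- **S5c (stub_coneLiouville) — K1 for cones, `TracelessConeLiouville` (conditional on (BU) for the cone).**
If the cone `Γ_κ(e) = {κ‖x‖ < ⟪x,e⟫}` (`0 ≤ κ < 1`, `‖e‖ = 1`) has the backward uniqueness property (BU) in the
`C¹₂` class — TRUE for `κ < 1/√3` by Li–Šverák 2012, Thm. 1.1 —, then a suitable weak Navier–Stokes solution on
the backward slab with a weak gradient, `𝐈 < ⊤` and the Type-I rate, which is apex-CALM and scar-FAINT on
`Γ_κ(e)`, is not singular at the origin.  Proof: S1c, S3c (with `s = R₀ + 1 + 2/(1−κ)`, `R₀ = max K 1`), S2c on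
the translated cone `s e + Γ_κ(e)`, S4' from the ball `B(s e + (6/(1−κ)) e, 3) ⊆ s e + Γ_κ(e)`, and the strips
`]-1/3, -1/(n+4)[` as in S5. [cite: LiSverak2012, Thm. 1.1] [cite: EscauriazaSereginSverak2003, Thm. 1.4 and §3] -/
theorem stub_coneLiouville :
    ∀ (κ : ℝ), 0 ≤ κ → κ < 1 → ∀ (e : E³), ‖e‖ = 1 →
      (∀ (v : ℝ × E³ → E³) (c₁ : ℝ), 0 ≤ c₁ →
        ContDiffOn ℝ 1 v (Ioo (0 : ℝ) 1 ×ˢ {y : E³ | κ * ‖y‖ < ⟪y, e⟫}) →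
        (∀ e' : E³, ContDiffOn ℝ 1 (Carleman.dx e' v) (Ioo (0 : ℝ) 1 ×ˢ {y : E³ | κ * ‖y‖ < ⟪y, e⟫})) →
        ContinuousOn v (Ico (0 : ℝ) 1 ×ˢ {y : E³ | κ * ‖y‖ < ⟪y, e⟫}) →
        (∀ y : E³, κ * ‖y‖ < ⟪y, e⟫ → v (0, y) = 0) →
        (∀ z ∈ Ioo (0 : ℝ) 1 ×ˢ {y : E³ | κ * ‖y‖ < ⟪y, e⟫},
          ‖Carleman.dt v z + Carleman.lap v z‖ ≤ c₁ * (‖v z‖ + Real.sqrt (Carleman.gradSq v z))) →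
        (∀ z ∈ Ioo (0 : ℝ) 1 ×ˢ {y : E³ | κ * ‖y‖ < ⟪y, e⟫}, ‖v z‖ ≤ 1) →
        (∀ K' ⊆ Ioo (0 : ℝ) 1 ×ˢ {y : E³ | κ * ‖y‖ < ⟪y, e⟫}, Bornology.IsBounded K' → MeasurableSet K' →
          ∫⁻ z in K', ‖Carleman.dt v z‖ₑ ^ 2 < ∞) →
        ∀ z ∈ Ioo (0 : ℝ) 1 ×ˢ {y : E³ | κ * ‖y‖ < ⟪y, e⟫}, v z = 0) →
      ∀ (C K : ℝ) (u : ℝ → E³ → E³) (p : ℝ → E³ → ℝ) (G : ℝ → E³ → E³ →L[ℝ] E³),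
      IsSuitableWeakSolutionOn 𝕊 1 0 u p → HasWeakSpatialGradientOn 𝕊 u G →
      typeIBound (Iio (0 : ℝ) ×ˢ univ) u p G < ⊤ → HasTypeITimeDecay C u →
      (∀ t : ℝ, t < 0 → ∀ x : E³, κ * ‖x‖ < ⟪x, e⟫ → ‖u t x‖ ≤ K / (‖x‖ + Real.sqrt (-t))) →
      (∀ ε : ℝ, 0 < ε → ∃ δ : ℝ, 0 < δ ∧ ∃ η : ℝ, 0 < η ∧ ∀ x : E³, κ * ‖x‖ < ⟪x, e⟫ → ‖x‖ < δ →
        ∀ t : ℝ, -η * ‖x‖ ^ 2 < t → t < 0 → ‖x‖ * ‖u t x‖ ≤ ε) →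
      ¬ IsBackwardSingularPoint u 0 := by
  intro κ hκ0 hκ1 e he hBU C K u p G hsw hwg hI hrate hcalm hfaint hsing
  -- ## S1c: blow-up at the origin
  obtain ⟨w, π, H, hsww, hH, hIw, hsingw, hratew, hcalmw, hfaintw⟩ :=
    stub_coneZoomLimit κ C K e u p G hsw hwg hI hrate hsing hcalm hfaint
  have h1κ : 0 < 1 - κ := by linarith
  have hinner : ∀ x : E³, ⟪x, e⟫ ≤ ‖x‖ := fun x => by
    have h := real_inner_le_norm x e
    rwa [he, mul_one] at h
  -- the far cone `F` and the translated cones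
  set R₀ : ℝ := max K 1 with hR₀def
  have hR₀ : 0 < R₀ := lt_of_lt_of_le one_pos (le_max_right _ _)
  set F : Set E³ := {x : E³ | κ * ‖x‖ < ⟪x, e⟫ ∧ R₀ < ⟪x, e⟫} with hFdef
  have hFo : IsOpen F := by
    have h1 : IsOpen {x : E³ | κ * ‖x‖ < ⟪x, e⟫} :=
      isOpen_lt (continuous_const.mul continuous_norm) (continuous_id.inner continuous_const)
    have h2 : IsOpen {x : E³ | R₀ < ⟪x, e⟫} :=
      isOpen_lt continuous_const (continuous_id.inner continuous_const)
    exact h1.inter h2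
  have hFm : MeasurableSet F := hFo.measurableSet
  have hfar : ∀ᵐ z ∂(volume.restrict (Ioo (-2 : ℝ) 0 ×ˢ F)), ‖w z.1 z.2‖ ≤ 1 := by
    have hsub : Ioo (-2 : ℝ) 0 ×ˢ F ⊆ Iio (0 : ℝ) ×ˢ (univ : Set E³) :=
      prod_mono Ioo_subset_Iio_self (subset_univ _)
    filter_upwards [ae_restrict_of_ae_restrict_of_subset hsub hcalmw,
      ae_restrict_mem (measurableSet_Ioo.prod hFm)] with z hz hzmem
    have hcone : κ * ‖z.2‖ < ⟪z.2, e⟫ := hzmem.2.1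
    have hxe : R₀ < ⟪z.2, e⟫ := hzmem.2.2
    have hxn : R₀ < ‖z.2‖ := lt_of_lt_of_le hxe (hinner z.2)
    have ht : z.1 < 0 := hzmem.1.2
    have hs : 0 < Real.sqrt (-z.1) := Real.sqrt_pos.2 (by linarith)
    refine (hz hcone).trans ?_
    rcases le_or_gt K 0 with hK | hK
    · exact (div_nonpos_of_nonpos_of_nonneg hK (by positivity)).trans zero_le_one
    · rw [div_le_one (by positivity)]
      have : K ≤ R₀ := le_max_left _ _
      linarith
  have hsmall : ∀ ε : ℝ, 0 < ε → ∃ s₀ : ℝ, s₀ < 0 ∧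
      ∀ᵐ z ∂(volume.restrict (Ioo s₀ 0 ×ˢ F)), ‖w z.1 z.2‖ ≤ ε := by
    intro ε hε
    obtain ⟨η, hη, hfw⟩ := hfaintw (ε * R₀) (by positivity)
    refine ⟨-(η * R₀ ^ 2), by rw [neg_lt_zero]; positivity, ?_⟩
    have hsub : Ioo (-(η * R₀ ^ 2)) 0 ×ˢ F ⊆ Iio (0 : ℝ) ×ˢ (univ : Set E³) :=
      prod_mono Ioo_subset_Iio_self (subset_univ _)
    filter_upwards [ae_restrict_of_ae_restrict_of_subset hsub hfw,
      ae_restrict_mem (measurableSet_Ioo.prod hFm)] with z hz hzmem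
    have hcone : κ * ‖z.2‖ < ⟪z.2, e⟫ := hzmem.2.1
    have hxe : R₀ < ⟪z.2, e⟫ := hzmem.2.2
    have hxn : R₀ < ‖z.2‖ := lt_of_lt_of_le hxe (hinner z.2)
    have hn0 : 0 < ‖z.2‖ := hR₀.trans hxn
    have htime : -η * ‖z.2‖ ^ 2 < z.1 := by
      have h1 : -(η * R₀ ^ 2) < z.1 := hzmem.1.1
      have h2 : R₀ ^ 2 < ‖z.2‖ ^ 2 := by nlinarith
      nlinarith
    have key : ‖z.2‖ * ‖w z.1 z.2‖ ≤ ε * R₀ := hz hcone htime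
    by_contra hcon
    push Not at hcon
    have : ε * R₀ < ‖z.2‖ * ‖w z.1 z.2‖ := by nlinarith
    linarith
  -- ## S3c: the far-field representative on the translated cone `s e + Γ`
  set s : ℝ := R₀ + 1 + 2 / (1 - κ) with hsdef
  have hs2 : 0 < 2 / (1 - κ) := by positivity
  have hs1 : R₀ + 1 ≤ s := by rw [hsdef]; linarith
  have hs3 : 1 + κ ≤ s * (1 - κ) := by
    rw [hsdef]
    have e1 : (R₀ + 1 + 2 / (1 - κ)) * (1 - κ) = (R₀ + 1) * (1 - κ) + 2 := by
      field_simp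
    rw [e1]
    nlinarith
  obtain ⟨Uf, Kf, hUf, hUfc, htop, hUf', hsol, hU4, hΦ, hKf⟩ :=
    stub_coneFarFieldRepresentative κ hκ0 hκ1 e he R₀ s hR₀ hs1 hs3 w π H hsww hH hIw hfar hsmall
  set x₀ : E³ := s • e with hx₀def
  set S : Set E³ := {x : E³ | κ * ‖x - s • e‖ < ⟪x - s • e, e⟫} with hSdef
  have hSo : IsOpen S :=
    isOpen_lt (continuous_const.mul (continuous_id.sub continuous_const).norm)
      ((continuous_id.sub continuous_const).inner continuous_const)
  -- ## S2c on the translated cone itself (`x₀ + Γ = S`)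
  have hx₀S : ∀ y : E³, κ * ‖y‖ < ⟪y, e⟫ → x₀ + y ∈ S := by
    intro y hy
    show κ * ‖x₀ + y - s • e‖ < ⟪x₀ + y - s • e, e⟫
    rw [hx₀def, add_sub_cancel_left]
    exact hy
  have hcurlS : ∀ z ∈ Ioo (-1 : ℝ) 0 ×ˢ {x : E³ | κ * ‖x - x₀‖ < ⟪x - x₀, e⟫}, curl (Uf z.1) z.2 = 0 :=
    stub_coneFarFieldCurl κ S hSo x₀ e he hx₀S hBU
      (fun t y => if κ * ‖y‖ < ⟪y, e⟫ ∧ R₀ < ⟪y, e⟫ then w t y else 0) Uf π Kf htop hUf' hsol hU4 hΦ hKf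
  -- ## S4' from the ball `B(x₁, 3)`, `x₁ = x₀ + (6/(1-κ)) e`, inside the translated cone
  set m : ℝ := 6 / (1 - κ) with hmdef
  have hm0 : 0 < m := by positivity
  have hm1 : 3 * (1 + κ) ≤ m * (1 - κ) := by
    rw [hmdef, div_mul_cancel₀ _ h1κ.ne']
    linarith
  set x₁ : E³ := x₀ + m • e with hx₁def
  have hball : ball x₁ 3 ⊆ {x : E³ | κ * ‖x - x₀‖ < ⟪x - x₀, e⟫} := by
    intro x hx
    rw [mem_ball, dist_eq_norm] at hx
    set b : E³ := x - x₁ with hbdef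
    have hxb : x - x₀ = m • e + b := by
      rw [hbdef, hx₁def]; abel
    show κ * ‖x - x₀‖ < ⟪x - x₀, e⟫
    rw [hxb]
    have hme : ‖m • e‖ = m := by rw [norm_smul, he, mul_one, Real.norm_of_nonneg hm0.le]
    have h1 : ‖m • e + b‖ ≤ m + 3 := by
      calc ‖m • e + b‖ ≤ ‖m • e‖ + ‖b‖ := norm_add_le _ _
        _ ≤ m + 3 := by rw [hme]; linarith [hx.le]
    have h2 : m - 3 < ⟪m • e + b, e⟫ := by
      rw [inner_add_left, real_inner_smul_left, real_inner_self_eq_norm_sq, he]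
      have hb : |⟪b, e⟫| ≤ ‖b‖ := by
        have := abs_real_inner_le_norm b e; rwa [he, mul_one] at this
      have hb' : -‖b‖ ≤ ⟪b, e⟫ := by linarith [abs_le.1 hb |>.1]
      nlinarith
    calc κ * ‖m • e + b‖ ≤ κ * (m + 3) := mul_le_mul_of_nonneg_left h1 hκ0
      _ ≤ m - 3 := by nlinarith
      _ < ⟪m • e + b, e⟫ := h2
  have hO : Ioo (-1 : ℝ) 0 ×ˢ ball x₁ 3 ⊆ Ioo (-1 : ℝ) 0 ×ˢ S := by
    refine prod_mono Subset.rfl ?_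
    intro x hx
    have h := hball hx
    show κ * ‖x - s • e‖ < ⟪x - s • e, e⟫
    simpa [hx₀def] using h
  have hUfB : uncurry Uf =ᵐ[volume.restrict (Ioo (-1 : ℝ) 0 ×ˢ ball x₁ 3)] uncurry w :=
    ae_restrict_of_ae_restrict_of_subset hO hUf
  have hUfcB : ContinuousOn (uncurry Uf) (Ioo (-1 : ℝ) 0 ×ˢ ball x₁ 3) := hUfc.mono hO
  have hcurlB : ∀ z ∈ Ioo (-1 : ℝ) 0 ×ˢ ball x₁ 3, curl (Uf z.1) z.2 = 0 :=
    fun z hz => hcurlS z ⟨hz.1, hball hz.2⟩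
  -- ## S4' on the strips `]-1/3, -1/(n+4)[`, the rate bounding the velocity there
  have hstrip : ∀ n : ℕ, ∀ᵐ t ∂(volume.restrict (Ioo (-(1 / 3 : ℝ)) (-(1 / ((n : ℝ) + 4))))),
      w t =ᵐ[volume] 0 := by
    intro n
    set b : ℝ := -(1 / ((n : ℝ) + 4)) with hbdef
    have hb : b < 0 := by rw [hbdef, neg_lt_zero]; positivity
    have hbd : ∀ᵐ z ∂(volume.restrict (Ioo (-(1 / 3 : ℝ) - 4 * (1 / 4 : ℝ) ^ 2) b ×ˢ (univ : Set E³))),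
        ‖w z.1 z.2‖ ≤ max C 0 / Real.sqrt (-b) := by
      have hsub : Ioo (-(1 / 3 : ℝ) - 4 * (1 / 4 : ℝ) ^ 2) b ×ˢ (univ : Set E³) ⊆
          Iio (0 : ℝ) ×ˢ (univ : Set E³) := prod_mono (fun t ht => ht.2.trans hb) Subset.rfl
      filter_upwards [ae_restrict_of_ae_restrict_of_subset hsub hratew,
        ae_restrict_mem (measurableSet_Ioo.prod MeasurableSet.univ)] with z hz hzmem
      have ht : z.1 < b := hzmem.1.2
      have hs' : 0 < Real.sqrt (-z.1) := Real.sqrt_pos.2 (by linarith)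
      have hsb : 0 < Real.sqrt (-b) := Real.sqrt_pos.2 (by linarith)
      calc ‖w z.1 z.2‖ ≤ C / Real.sqrt (-z.1) := hz
        _ ≤ max C 0 / Real.sqrt (-z.1) := div_le_div_of_nonneg_right (le_max_left _ _) hs'.le
        _ ≤ max C 0 / Real.sqrt (-b) :=
            div_le_div_of_nonneg_left (le_max_right _ _) hsb (Real.sqrt_le_sqrt (by linarith))
    exact stub_ballStripLiouville x₁ w π H Uf hsww hH hIw hUfB hUfcB hcurlB (-(1 / 3 : ℝ)) b (1 / 4)
      (max C 0 / Real.sqrt (-b)) (by norm_num) (by norm_num) hb.le hbd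
  -- ## `w(t) = 0` a.e. for a.e. `t ∈ ]-1/3, 0[`
  have hae0 : ∀ᵐ t ∂(volume.restrict (Ioo (-(1 / 3 : ℝ)) 0)), w t =ᵐ[volume] 0 := by
    have hcov : Ioo (-(1 / 3 : ℝ)) 0 ⊆ ⋃ n : ℕ, Ioo (-(1 / 3 : ℝ)) (-(1 / ((n : ℝ) + 4))) := by
      intro t ht
      obtain ⟨n, hn⟩ := exists_nat_one_div_lt (neg_pos.2 ht.2)
      refine mem_iUnion.2 ⟨n, ht.1, ?_⟩
      have h1 : 1 / ((n : ℝ) + 4) ≤ 1 / ((n : ℝ) + 1) :=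
        one_div_le_one_div_of_le (by positivity) (by linarith)
      linarith
    refine ae_restrict_of_ae_restrict_of_subset hcov ?_
    rw [ae_restrict_iUnion_iff]
    exact hstrip
  -- ## `w = 0` a.e. on `Q(0, 1/2)`: the origin is not singular
  have hQ : parabolicCylinder (1 / 2) (0 : ℝ × E³) = Ioo (-(1 / 4 : ℝ)) 0 ×ˢ ball (0 : E³) (1 / 2) := by
    rw [parabolicCylinder]
    simp only [Prod.fst_zero, Prod.snd_zero, zero_sub]
    norm_num
  have hwmQ : AEStronglyMeasurable (uncurry w)
      (volume.restrict (parabolicCylinder (1 / 2) (0 : ℝ × E³))) :=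
    hH.locallyIntegrableOn.aestronglyMeasurable.mono_measure
      (Measure.restrict_mono (parabolicCylinder_subset_slab _ le_rfl) le_rfl)
  have hzero : ∫⁻ z in parabolicCylinder (1 / 2) (0 : ℝ × E³), ‖w z.1 z.2‖ₑ = 0 := by
    have hf : AEMeasurable (fun z : ℝ × E³ => ‖w z.1 z.2‖ₑ)
        ((volume.restrict (Ioo (-(1 / 4 : ℝ)) 0)).prod (volume.restrict (ball (0 : E³) (1 / 2)))) := by
      rw [Measure.prod_restrict, ← Measure.volume_eq_prod, ← hQ]
      exact hwmQ.enorm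
    rw [hQ, Measure.volume_eq_prod, ← Measure.prod_restrict, lintegral_prod _ hf]
    refine (lintegral_congr_ae ?_).trans lintegral_zero
    filter_upwards [ae_restrict_of_ae_restrict_of_subset (Ioo_subset_Ioo (by norm_num) le_rfl) hae0] with t ht
    refine (lintegral_congr_ae ?_).trans lintegral_zero
    filter_upwards [ae_restrict_of_ae ht] with x hx
    simp [hx]
  have hae : ∀ᵐ z ∂(volume.restrict (parabolicCylinder (1 / 2) (0 : ℝ × E³))),
      uncurry w z = (0 : ℝ × E³ → E³) z := by
    have h := (lintegral_eq_zero_iff' hwmQ.enorm).1 hzero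
    filter_upwards [h] with ⟨t, x⟩ hz
    have hz' : ‖w t x‖ₑ = 0 := hz
    simpa using hz'
  have h0 : eLpNorm (uncurry w) ⊤ (volume.restrict (parabolicCylinder (1 / 2) (0 : ℝ × E³))) = 0 :=
    (eLpNorm_eq_zero_iff hwmQ ENNReal.top_ne_zero).2 hae
  have h := hsingw (1 / 2) (by norm_num)
  rw [h0] at h
  exact ENNReal.zero_ne_top h

end Summit.NavierStokesRegularity.NavierStokesRegularity.Theorems.RellichScarApexLocalisation

end
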